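import Summits.QuantumFields.YangMills.Theorems.UnitScaleTiltHalvingP1FlatCoreTopLinearKnit
import Literature.MathematicalPhysics.QuantumFieldTheory.Balaban1983to89.B8Eq142KLevelLocal
import Literature.MathematicalPhysics.QuantumFieldTheory.Balaban1983to89.B8Prop6OfThm4
import HarnessLib

/-!
# Line H (`BirthV10.stub_halvingStep`, stmt-QuantumFields-19200), row (P3-top) **(W1): THE (1.42) CLAUSE OF PROPOSITION 3 AT THE TOP STEP —
# `h42` of ✓`B8Prop3KLevel.prop3_norms_kLevel` at `U₀ = 1` for the final gauge-fixed triple `(u, W, A′)`, levels `j < k` from (1.29)∕(1.19) BELOW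
# the top (✓`B8Eq142KLevelLocal.H42_of_inAx`), the top level `j = k` from the LINEAR KNIT (✓`P1FlatCoreTopLinearKnit`, LEAD-H RULING L-9)**

Cell `ym3-torus` (HUMAN RULING D-0037: YM₃ on T³ is ladder rung R3, NOT the Clay problem), width seat `ym-ust-19936-w8` gen 3; LEAD-H RULING L-10 ([R-h]).
`--supports stmt-QuantumFields-19200 --as helper`; THEOREMS ONLY (0 `def`, 0 `sorry`); count-neutral; nothing here claims `core′`, `hSupU`, the stub, the crux or the gap.

THE POINT ([Balaban1985RegularSpaces] (1.42) p. 83, Prop. 3 p. 87).  Proposition 3 at `k` levels consumes «`|Q_j(U₀, ηA′)(c)| < 2dLα₁` on the constraint bonds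
`c ∈ Λ_j`, `j ≤ k`» (`h42` of ✓`prop3_norms_kLevel`; the guarded binders `H42` of ✓`B8Prop3GaugeFixedKLevel.hP3_gaugeFixed_of_b9` ∕
✓`B8Thm2GaugeFixedKLevel.thm2_norms_gaugeFixed_kLevel`).  In print, and in the tree's ✓`B8Eq142KLevelLocal.H42_of_inAx`, every level comes from the (1.29)
normalisation of the gauge `u` AT THAT LEVEL together with the axial structure (1.19) and (1.35).  At the H-line's TOP step (`k = K − n`, flat background `U₀ = 1`)
the final gauge is (1.29)-normalised only BELOW the top — the top block carries the (o)-normalisation of the chart instead (P3TOP-LOCATE §0, ★w3-19936 g6) — so: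
levels `j < k` are ✓`H42_of_inAx` READ WITH THE TOP INDEX SET EMPTIED (`Function.update Λs k ∅`: every clause at `j < k` unchanged, the `j = k` clause vacuous),
and the top level `j = k` is the LINEAR KNIT ✓`P1FlatCoreTopLinearKnit.norm_logCovIter_one_le_norm_mlog_dbarIterU_of_socket`: the comb functional `Q_k(1, iηA′)(c)` is
the torus double-bar top variable `log U̿^{(k)}(W♭)(c♭)` up to `(C₂(d) + 64·60800·((d+2)L)²)·α₂²`, and `‖log U̿^{(k)}(W♭)(c♭)‖ ≤ t` is the displayed (o)-row
(✓`P1FlatCoreDP1TopBonds.norm_mlog_dbarIterU_chart_le_of_top`, row (L4): `t = 2ϱε₁`).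

WHAT.
* §1 ★★★ `h42_top_of_below_and_knit` — at `𝔸 := M_n(ℂ)` (operator norm; the knit's carrier), torus parameters `P` (`d ≥ 2`, `L ≥ 2`), `1 ≤ k ≤ m + K`, `η > 0`,
  for ONE triple `(u, W, A′)` (`u` unitary-valued, `W^{u} = U′` at `U₀ = 1`, `Restr129 L k (Function.update Λs k ∅) 1 u` = «(1.29) below the top», `A′` self-adjoint,
  the chart∕size socket `W = e^{iηA′}`, `‖A′‖ ≤ α₂(Lʲη)⁻¹` on `SideTouches (Ω j)`, `j ≤ k`), the standing rows of ✓`H42_of_inAx` at `U₀ = 1` read below the top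
  ((1.34) `InAk … (U′·1)`, (1.19)-axial `InAx L k (Function.update Λs k ∅) 1 (U′·1)`, (1.35) `‖Ū′ʲ − 1‖ ≤ α₁` on the bonds with box in `Ω_j`, `j < k`, boxes ∕ bond classes
  of the constraint bonds `Λb j`, `j < k`, the windows at a free `α₂`), and THE TOP DATA in the knit's torus letters per top constraint bond `c ∈ Λb k` (a torus exponent
  field `Af` and configuration `Wf` with `A′ = Af ∘ π` on the comb box of `c`, `Wf = e^{iηAf}` and `‖Af‖ ≤ α₂(Lᵏη)⁻¹` on the reads of `c♭ = ⟨π_k c₋, κ⟩`,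
  `‖log U̿^{(k)}(Wf)(c♭)‖ ≤ t`) under the windows `α₂ ≤ c₄(d)`, `243200((d+2)L)²α₂ ≤ 1`, `t + (C₂(d) + 64·60800·((d+2)L)²)α₂² < 2dLα₁`:
  **`∀ j ≤ k, ∀ c ∈ Λb j, ‖Q_j(1, iηA′)(c)‖ < 2dLα₁`.**  The mask row of the guarded binders («`A′ = 0` off `⋃ SideTouches (Ω j)`») is NOT asked: §1 masks
  internally and returns to `A′` by the locality ✓`B7LocalityGeneral.logCovIter_congr` (the box of a constraint bond lies in `Ω_j`, `hbox`).
HONEST SCOPE.  A junction of two landed theorems; no analysis here.  The (1.42) clause below the top is ✓`H42_of_inAx`'s (n04-b lineage); the top clause is rows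
(L1)–(L4) through the knit; (1.35), (1.34), (1.19), (1.29)-below-the-top, the chart socket and the (o)-row are the caller's (STAGE 3 of LEAD-H BOARD v2).  Nothing of
Propositions 3∕4 or Theorem 2 of [Balaban1985RegularSpaces] is proved in this file.

References: T. Bałaban, CMP **99** (1985) 75–102 [Balaban1985RegularSpaces] ((1.42) p.83, (1.29) p.81, (1.19) p.79, (1.35) p.82, Prop. 3 p.87, Thm 4 p.88);
CMP **98** (1985) 17–51 [Balaban1985Averaging] (Prop. 4 pp.38–39, p.24); CMP **102** (1985) 277–309 [Balaban1985Variational] ((152)–(156) pp.301–302).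
-/

set_option autoImplicit false

noncomputable section

open scoped BigOperators Matrix.Norms.L2Operator

namespace Summit.QuantumFields.YangMills.Theorems.P1FlatCoreTopH42

open Literature.MathematicalPhysics.QuantumFieldTheory.Balaban1983to89
open T4Continuum MatrixLog
open B15Eq112TorusCover (cover)
open B14DomainGeom (Pt)
open Node00 (coverAt)
open B5Eq118OneStroke (iterBlockOf)
open B7Prop1Explicit (e)
open B7Prop2Explicit (unitaryUnits avgIter C0 c2')
open B7Prop1Local (InBox AgreeOn loK bondHiK)
open B7Prop3Flat (c3)
open B7Prop4Flat (C2 c4)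
open B7Prop4GeneralLevels (logCovIter)
open B7LocalityGeneral (logCovIter_congr)
open B7Eq92Concrete (mgauge)
open B8Lemma1NonAbelian (mulCfg)
open B8Eq146AExpansion (iEta)
open B8Eq184Proof (cfgExp)
open B8Ineq132 (InAk)
open B8Eq140Level (SideTouches sideTouches_of_bondTouches)
open B8Eq119TwistedAxial (InAx Restr129)
open B8Thm2LogB (blockTop)
open Summit.QuantumFields.YangMills.Theorems.Prop8Chart (expCfg)
open Summit.QuantumFields.YangMills.Theorems.Prop8ChartDoubleBar (dbarIterU)
open Summit.QuantumFields.YangMills.Theorems.P1FlatCoreTopLinearKnit (norm_logCovIter_one_le_norm_mlog_dbarIterU_of_socket)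

variable {P : Params} {n : Type*} [Fintype n] [DecidableEq n] [Nonempty n]

/-! ## §1 The (1.42) clause at all levels of the top step: below the top by (1.29)∕(1.19), at the top by the linear knit -/

/-- ★★★ **THE (1.42) CLAUSE `h42` OF PROPOSITION 3 AT THE TOP STEP, `U₀ = 1`** — for the final gauge-fixed triple `(u, W, A′)` of the H-line's `k`-th step:
`∀ j ≤ k, ∀ c ∈ Λb j, ‖Q_j(1, iηA′)(c)‖ < 2dLα₁`.  Levels `j < k`: ✓`B8Eq142KLevelLocal.H42_of_inAx` with the top index set emptied (`Function.update Λs k ∅`),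
applied to the internally masked field `𝟙_{⋃_{j ≤ k} SideTouches (Ω j)}·A′` and returned to `A′` by ✓`B7LocalityGeneral.logCovIter_congr` (`hbox`: the box of a
constraint bond lies in `Ω_j`, whose bonds are sides touching `Ω_j` as `d ≥ 2`).  Level `j = k`: ✓`P1FlatCoreTopLinearKnit.norm_logCovIter_one_le_norm_mlog_dbarIterU_of_socket`
at each top constraint bond, `+` the displayed (o)-row `‖log U̿^{(k)}(Wf)(c♭)‖ ≤ t` and the window `t + (C₂(d) + 64·60800·((d+2)L)²)·α₂² < 2dLα₁`.
[cite: Balaban1985RegularSpaces, (1.42) p.83, Prop. 3 p.87, (1.29) p.81, (1.19) p.79, (1.35) p.82; Balaban1985Averaging, Prop. 4 pp.38-39; Balaban1985Variational, (152)-(156) pp.301-302] -/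
theorem h42_top_of_below_and_knit (hd2 : 2 ≤ P.d) (hL : 2 ≤ P.L) {k : ℕ} (hk1 : 1 ≤ k) (hk : k ≤ P.m + P.K)
    {η : ℝ} (hη : 0 < η) {U' : Pt P.d → Fin P.d → (Matrix n n ℂ)ˣ}
    {α₀ α₁ α₂ : ℝ} (hα₀ : 0 < α₀) (hα₁ : 0 < α₁) (hα₂ : 0 ≤ α₂)
    (hα3 : C0 P.d * α₀ ≤ 1 / 3) (hα4 : 4 * α₀ ≤ c2' P.d P.L) (h16 : 16 * α₂ ≤ 1)
    (hsmall : Real.exp (4 * (800 * ((P.d : ℝ) + 1) ^ 2 * ((P.d : ℝ) + 4)) * α₀) * (1 + 8 * (131072 * ((P.d : ℝ) + 1) ^ 2) * α₂) ≤ 2)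
    (hc₃ : 2 * α₂ ≤ c3 P.d P.L) (hsmall₁ : (P.d : ℝ) * P.L * α₁ ≤ 1 / 8)
    (Ω : ℕ → Set (Pt P.d)) (hΩ : ∀ j, Ω (j + 1) ⊆ Ω j)
    (Λs : ℕ → Set (Pt P.d)) (Λb : ℕ → Set (Pt P.d × Fin P.d))
    (hbox : ∀ j, j < k → ∀ c ∈ Λb j, ∀ x, InBox (loK P.L j c.1) (bondHiK P.L j c.1 c.2) x → x ∈ Ω j)
    (hclass : ∀ j, j < k → ∀ c ∈ Λb j,
      (c.1 ∈ Λs j ∧ c.1 + e c.2 ∈ Λs j) ∨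
      (∃ j', j = j' + 1 ∧ (∀ x, (P.L : ℤ) • c.1 ≤ x → x ≤ (P.L : ℤ) • c.1 + blockTop P.L → x ∈ Λs j') ∧ c.1 + e c.2 ∈ Λs j) ∨
      (∃ j', j = j' + 1 ∧ c.1 ∈ Λs j ∧
        (∀ x, (P.L : ℤ) • (c.1 + e c.2) ≤ x → x ≤ (P.L : ℤ) • (c.1 + e c.2) + blockTop P.L → x ∈ Λs j')))
    (h34 : InAk P.L k η α₀ Ω (mulCfg U' 1))
    (hAx : InAx P.L k (Function.update Λs k ∅) 1 (mulCfg U' 1))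
    (h135 : ∀ j, j ≤ k → ∀ (z : Pt P.d) (μ : Fin P.d), (∀ x, InBox (loK P.L j z) (bondHiK P.L j z μ) x → x ∈ Ω j) →
      ‖((avgIter P.L (mulCfg U' 1) j z μ : (Matrix n n ℂ)ˣ) : Matrix n n ℂ) - 1‖ ≤ α₁)
    {u : Pt P.d → (Matrix n n ℂ)ˣ} {W : Pt P.d → Fin P.d → (Matrix n n ℂ)ˣ} {A' : Pt P.d → Fin P.d → Matrix n n ℂ}
    (hu : ∀ x, u x ∈ unitaryUnits (Matrix n n ℂ)) (hW : mgauge 1 u W = U')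
    (h129 : Restr129 P.L k (Function.update Λs k ∅) 1 u)
    (hsa : ∀ y τ, IsSelfAdjoint (A' y τ))
    (hsock : ∀ j, j ≤ k → ∀ y τ, SideTouches (Ω j) y τ →
      W y τ = cfgExp η A' y τ ∧ ‖A' y τ‖ ≤ α₂ * ((P.L : ℝ) ^ j * η)⁻¹)
    (Af : PBond P 0 → Matrix n n ℂ) (Wf : GaugeField P 0 (Matrix n n ℂ)ˣ)
    (hjunc : ∀ c ∈ Λb k, AgreeOn (loK P.L k c.1) (bondHiK P.L k c.1 c.2) A' (fun w μ => Af ⟨cover P w, μ⟩))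
    (hWf : ∀ c ∈ Λb k, ∀ b : PBond P 0,
      (iterBlockOf k b.src = (⟨coverAt P k c.1, c.2⟩ : PBond P k).src ∨ iterBlockOf k b.src = (⟨coverAt P k c.1, c.2⟩ : PBond P k).tgt) →
      (iterBlockOf k b.tgt = (⟨coverAt P k c.1, c.2⟩ : PBond P k).src ∨ iterBlockOf k b.tgt = (⟨coverAt P k c.1, c.2⟩ : PBond P k).tgt) →
        Wf b = expCfg η Af b)
    (hAf : ∀ c ∈ Λb k, ∀ b : PBond P 0,
      (iterBlockOf k b.src = (⟨coverAt P k c.1, c.2⟩ : PBond P k).src ∨ iterBlockOf k b.src = (⟨coverAt P k c.1, c.2⟩ : PBond P k).tgt) →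
      (iterBlockOf k b.tgt = (⟨coverAt P k c.1, c.2⟩ : PBond P k).src ∨ iterBlockOf k b.tgt = (⟨coverAt P k c.1, c.2⟩ : PBond P k).tgt) →
        ‖Af b‖ ≤ α₂ * ((P.L : ℝ) ^ k * η)⁻¹)
    (hkb : α₂ ≤ c4 P.d) (hbudget : 243200 * (((P.d + 2) * P.L : ℕ) : ℝ) ^ 2 * α₂ ≤ 1)
    {t : ℝ} (htop : ∀ c ∈ Λb k, ‖mlog ((dbarIterU k Wf ⟨coverAt P k c.1, c.2⟩ : (Matrix n n ℂ)ˣ) : Matrix n n ℂ)‖ ≤ t)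
    (hwin : t + (C2 P.d + 64 * 60800 * (((P.d + 2) * P.L : ℕ) : ℝ) ^ 2) * α₂ ^ 2 < 2 * (P.d : ℝ) * P.L * α₁) :
    ∀ j, j ≤ k → ∀ c ∈ Λb j, ‖logCovIter P.L 1 (iEta η A') j c.1 c.2‖ < 2 * (P.d : ℝ) * P.L * α₁ := by
  classical
  letI : CStarAlgebra (Matrix n n ℂ) := {}
  have hL1 : 1 ≤ P.L := le_trans (by norm_num) hL
  haveI : Nontrivial (Fin P.d) := Fin.nontrivial_iff_two_le.mpr hd2
  intro j hj c hc
  rcases hj.lt_or_eq with hlt | rfl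
  swap
  · -- THE TOP LEVEL: the linear knit at the top constraint bond `c`
    have h := norm_logCovIter_one_le_norm_mlog_dbarIterU_of_socket hL hk1 hk hη Af A' Wf c.1 c.2 (hjunc c hc) (hWf c hc)
      hα₂ (hAf c hc) hkb hbudget
    have ht := htop c hc
    linarith
  -- BELOW THE TOP: `H42_of_inAx` with the top index set emptied, on the masked field
  -- a bond of the box of a constraint bond is a side touching `Ω_j`
  have hside : ∀ {j : ℕ} {x : Pt P.d} (μ : Fin P.d), x ∈ Ω j → SideTouches (Ω j) x μ := fun {j x} μ hx => by
    obtain ⟨ν, hν⟩ := exists_ne μ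
    exact sideTouches_of_bondTouches hν (Or.inl hx)
  -- the mask and the masked field
  set M : Set (Pt P.d × Fin P.d) := {b | ∃ i, i ≤ k ∧ SideTouches (Ω i) b.1 b.2} with hM_def
  set A'' : Pt P.d → Fin P.d → Matrix n n ℂ := fun y τ => if (y, τ) ∈ M then A' y τ else 0 with hA''_def
  have hA''_of_mem : ∀ {y : Pt P.d} {τ : Fin P.d}, (y, τ) ∈ M → A'' y τ = A' y τ := fun {y τ} h => by
    simp only [hA''_def, if_pos h]
  have hsa'' : ∀ y τ, IsSelfAdjoint (A'' y τ) := by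
    intro y τ
    by_cases h : (y, τ) ∈ M
    · rw [hA''_of_mem h]; exact hsa y τ
    · have : A'' y τ = 0 := by simp only [hA''_def, if_neg h]
      rw [this]; exact IsSelfAdjoint.zero _
  have hsock'' : ∀ i, i ≤ k → ∀ y τ, SideTouches (Ω i) y τ →
      W y τ = cfgExp η A'' y τ ∧ ‖A'' y τ‖ ≤ α₂ * ((P.L : ℝ) ^ i * η)⁻¹ := by
    intro i hi y τ hs
    have hmem : (y, τ) ∈ M := ⟨i, hi, hs⟩
    obtain ⟨hWy, hAy⟩ := hsock i hi y τ hs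
    refine ⟨?_, by rw [hA''_of_mem hmem]; exact hAy⟩
    rw [hWy]
    exact B8Prop3GaugeFixedKLevel.cfgExp_congr_at η (hA''_of_mem hmem).symm
  have hA''0 : ∀ y τ, (∀ i, i ≤ k → ¬ SideTouches (Ω i) y τ) → A'' y τ = 0 := by
    intro y τ h
    have hn : (y, τ) ∉ M := fun ⟨i, hi, hs⟩ => h i hi hs
    simp only [hA''_def, if_neg hn]
  -- the standing rows of `H42_of_inAx` at `U₀ = 1` for the emptied families
  have hU₀ : ∀ (x : Pt P.d) (κ : Fin P.d), (1 : Pt P.d → Fin P.d → (Matrix n n ℂ)ˣ) x κ ∈ unitaryUnits (Matrix n n ℂ) :=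
    fun _ _ => (unitaryUnits (Matrix n n ℂ)).one_mem
  have h33 : InAk P.L k η α₀ Ω (1 : Pt P.d → Fin P.d → (Matrix n n ℂ)ˣ) := B8Prop6OfThm4.one_inAk hL1 k hη hα₀ Ω
  have hupd : ∀ {i : ℕ}, i < k → Function.update Λs k ∅ i = Λs i := fun {i} hi => Function.update_of_ne (Nat.ne_of_lt hi) _ _
  have h135' : ∀ i, i ≤ k → ∀ (z : Pt P.d) (μ : Fin P.d), (∀ x, InBox (loK P.L i z) (bondHiK P.L i z μ) x → x ∈ Ω i) →
      ‖((avgIter P.L (mulCfg U' 1) i z μ : (Matrix n n ℂ)ˣ) : Matrix n n ℂ) -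
        ((avgIter P.L (1 : Pt P.d → Fin P.d → (Matrix n n ℂ)ˣ) i z μ : (Matrix n n ℂ)ˣ) : Matrix n n ℂ)‖ ≤ α₁ := by
    intro i hi z μ hzΩ
    have e1 : ((avgIter P.L (1 : Pt P.d → Fin P.d → (Matrix n n ℂ)ˣ) i z μ : (Matrix n n ℂ)ˣ) : Matrix n n ℂ) = 1 := by
      rw [B7Eq92Concrete.avgIter_one]; rfl
    rw [e1]; exact h135 i hi z μ hzΩ
  -- membership in the internal constraint-bond family
  have hmemb : ∀ {m i : ℕ} {c' : Pt P.d × Fin P.d},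
      c' ∈ (fun m i => if m = k ∧ i < k then Λb i else (∅ : Set (Pt P.d × Fin P.d))) m i → i < k ∧ c' ∈ Λb i := by
    intro m i c' h
    dsimp only at h
    by_cases hmi : m = k ∧ i < k
    · rw [if_pos hmi] at h; exact ⟨hmi.2, h⟩
    · rw [if_neg hmi] at h; exact False.elim ((Set.mem_empty_iff_false _).mp h)
  have H := B8Eq142KLevelLocal.H42_of_inAx (U₀ := 1) hd2 hη hL k hU₀ hα₀ hα₁ hα₂ hα3 hα4 h16 hsmall hc₃ hsmall₁ Ω hΩ
    (fun _ => Function.update Λs k ∅) (fun m i => if m = k ∧ i < k then Λb i else ∅) ?_ ?_ h33 h34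
    (fun m hm i hi1 him => hAx i hi1 (him.trans hm)) h135' (fun _ _ => True)
  rotate_left
  · -- boxes of the constraint bonds below the top lie in `Ω_j`
    intro m _ i _ c' hc' x hx
    obtain ⟨hik, hc'b⟩ := hmemb hc'
    exact hbox i hik c' hc'b x hx
  · -- the bond classes below the top, read in the emptied family
    intro m _ i _ c' hc'
    obtain ⟨hik, hc'b⟩ := hmemb hc'
    rw [hupd hik]
    rcases hclass i hik c' hc'b with h1 | ⟨j', hij, hblk, h2⟩ | ⟨j', hij, h1, hblk⟩
    · exact Or.inl h1
    · refine Or.inr (Or.inl ⟨j', hij, fun x hx1 hx2 => ?_, h2⟩)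
      rw [hupd (by omega)]; exact hblk x hx1 hx2
    · refine Or.inr (Or.inr ⟨j', hij, h1, fun x hx1 hx2 => ?_⟩)
      rw [hupd (by omega)]; exact hblk x hx1 hx2
  -- the masked conclusion at `(j, c)`, returned to `A′` by locality
  have hc' : c ∈ (fun m i => if m = k ∧ i < k then Λb i else (∅ : Set (Pt P.d × Fin P.d))) k j := by
    show c ∈ (if k = k ∧ j < k then Λb j else (∅ : Set (Pt P.d × Fin P.d)))
    rw [if_pos ⟨rfl, hlt⟩]; exact hc
  have key := H k hk1 le_rfl u W A'' hu hW h129 trivial hsa'' hsock'' hA''0 j hlt.le c hc'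
  have hag : AgreeOn (loK P.L j c.1) (bondHiK P.L j c.1 c.2) (iEta η A') (iEta η A'') := by
    intro x μ hx _
    have hmem : (x, μ) ∈ M := ⟨j, hlt.le, hside μ (hbox j hlt c hc x hx)⟩
    show ((Complex.I : ℂ) * η) • A' x μ = ((Complex.I : ℂ) * η) • A'' x μ
    rw [hA''_of_mem hmem]
  rw [logCovIter_congr P.L hL1 j c.1 c.2 (fun _ _ _ _ => rfl) hag]
  exact key

/-! ## §2 (v1.1) The same in the GUARDED binder shape of ✓`hP3_gaugeFixed_of_b9` ∕ ✓`HalvingP1FlatCoreTopSizes.prop3_sizes_top` at the single level `k` -/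

omit [Fintype n] [DecidableEq n] [Nonempty n] in
/-- scalar bookkeeping of the chart: `(iη)·(η⁻¹·(i⁻¹·X)) = X`. [cite: Balaban1985Variational, (152) p.301] -/
theorem smul_chart_cancel {η : ℝ} (hη : η ≠ 0) (X : Matrix n n ℂ) :
    (Complex.I * (η : ℂ)) • (η⁻¹ • ((Complex.I⁻¹ : ℂ) • X)) = X := by
  rw [← algebraMap_smul ℂ η⁻¹ ((Complex.I⁻¹ : ℂ) • X), smul_smul, smul_smul, Complex.coe_algebraMap, Complex.ofReal_inv]
  have hη' : (η : ℂ) ≠ 0 := Complex.ofReal_ne_zero.mpr hη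
  have h : Complex.I * (η : ℂ) * (η : ℂ)⁻¹ * Complex.I⁻¹ = 1 := by
    field_simp
  rw [h, one_smul]

/-- ★★ **(W1) IN THE GUARDED BINDER SHAPE** — the `H42` binder of ✓`B8Prop3GaugeFixedKLevel.hP3_gaugeFixed_of_b9` read at the single level `m = k`
(= the `H42` input of ★w6-19200 g2's ✓`HalvingP1FlatCoreTopSizes.prop3_sizes_top`), at `U₀ = 1`, for the families `Λs k := Function.update Λs k ∅`
(«(1.29) below the top»), `Λb k j := Λb j`, and ANY Landau predicate `Lan` that hands the cover pull-back identity `W = Wf ∘ π` on the comb boxes of the top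
constraint bonds (`hLan`; STAGE 3 takes `Lan k W := IsLandau138W … W ∧ <that identity>`).  For every admissible `(u, W, A′)` the junction `A′ = Af ∘ π`
with `Af := η⁻¹·i⁻¹·log Wf` is DERIVED on the comb boxes from the chart socket by `log ∘ exp = id` (✓`B8Prop3GaugeFixedKLevel.log_cfgExp_eq`,
`16α₂ ≤ 1`), and the torus rows of §1 from the displayed near-flatness `‖Wf − 1‖ ≤ r` on the reads (`r ≤ ½`, `2r ≤ α₂L⁻ᵏ`: ✓`MatrixLog.exp_mlog`,
✓`MatrixLog.norm_mlog_le_two_mul`); then §1. [cite: Balaban1985RegularSpaces, (1.42) p.83, Prop. 3 p.87, Thm 4 p.88; Balaban1985Variational, (152)-(156) pp.301-302] -/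
theorem H42_top_guarded (hd2 : 2 ≤ P.d) (hL : 2 ≤ P.L) {k : ℕ} (hk1 : 1 ≤ k) (hk : k ≤ P.m + P.K)
    {η : ℝ} (hη : 0 < η) {U' : Pt P.d → Fin P.d → (Matrix n n ℂ)ˣ}
    {α₀ α₁ α₂ : ℝ} (hα₀ : 0 < α₀) (hα₁ : 0 < α₁) (hα₂ : 0 ≤ α₂)
    (hα3 : C0 P.d * α₀ ≤ 1 / 3) (hα4 : 4 * α₀ ≤ c2' P.d P.L) (h16 : 16 * α₂ ≤ 1)
    (hsmall : Real.exp (4 * (800 * ((P.d : ℝ) + 1) ^ 2 * ((P.d : ℝ) + 4)) * α₀) * (1 + 8 * (131072 * ((P.d : ℝ) + 1) ^ 2) * α₂) ≤ 2)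
    (hc₃ : 2 * α₂ ≤ c3 P.d P.L) (hsmall₁ : (P.d : ℝ) * P.L * α₁ ≤ 1 / 8)
    (Ω : ℕ → Set (Pt P.d)) (hΩ : ∀ j, Ω (j + 1) ⊆ Ω j)
    (Λs : ℕ → Set (Pt P.d)) (Λb : ℕ → Set (Pt P.d × Fin P.d))
    (hbox : ∀ j, j ≤ k → ∀ c ∈ Λb j, ∀ x, InBox (loK P.L j c.1) (bondHiK P.L j c.1 c.2) x → x ∈ Ω j)
    (hclass : ∀ j, j < k → ∀ c ∈ Λb j,
      (c.1 ∈ Λs j ∧ c.1 + e c.2 ∈ Λs j) ∨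
      (∃ j', j = j' + 1 ∧ (∀ x, (P.L : ℤ) • c.1 ≤ x → x ≤ (P.L : ℤ) • c.1 + blockTop P.L → x ∈ Λs j') ∧ c.1 + e c.2 ∈ Λs j) ∨
      (∃ j', j = j' + 1 ∧ c.1 ∈ Λs j ∧
        (∀ x, (P.L : ℤ) • (c.1 + e c.2) ≤ x → x ≤ (P.L : ℤ) • (c.1 + e c.2) + blockTop P.L → x ∈ Λs j')))
    (h34 : InAk P.L k η α₀ Ω (mulCfg U' 1))
    (hAx : InAx P.L k (Function.update Λs k ∅) 1 (mulCfg U' 1))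
    (h135 : ∀ j, j ≤ k → ∀ (z : Pt P.d) (μ : Fin P.d), (∀ x, InBox (loK P.L j z) (bondHiK P.L j z μ) x → x ∈ Ω j) →
      ‖((avgIter P.L (mulCfg U' 1) j z μ : (Matrix n n ℂ)ˣ) : Matrix n n ℂ) - 1‖ ≤ α₁)
    (Lan : ℕ → (Pt P.d → Fin P.d → (Matrix n n ℂ)ˣ) → Prop) (Wf : GaugeField P 0 (Matrix n n ℂ)ˣ)
    (hLan : ∀ W : Pt P.d → Fin P.d → (Matrix n n ℂ)ˣ, Lan k W → ∀ c ∈ Λb k, ∀ (y : Pt P.d) (τ : Fin P.d),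
      InBox (loK P.L k c.1) (bondHiK P.L k c.1 c.2) y → InBox (loK P.L k c.1) (bondHiK P.L k c.1 c.2) (y + e τ) →
        W y τ = Wf ⟨cover P y, τ⟩)
    {r : ℝ} (hr : r ≤ 1 / 2) (hr2 : 2 * r ≤ α₂ * ((P.L : ℝ) ^ k)⁻¹)
    (hWf1 : ∀ c ∈ Λb k, ∀ b : PBond P 0,
      (iterBlockOf k b.src = (⟨coverAt P k c.1, c.2⟩ : PBond P k).src ∨ iterBlockOf k b.src = (⟨coverAt P k c.1, c.2⟩ : PBond P k).tgt) →
      (iterBlockOf k b.tgt = (⟨coverAt P k c.1, c.2⟩ : PBond P k).src ∨ iterBlockOf k b.tgt = (⟨coverAt P k c.1, c.2⟩ : PBond P k).tgt) →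
        ‖((Wf b : (Matrix n n ℂ)ˣ) : Matrix n n ℂ) - 1‖ ≤ r)
    (hkb : α₂ ≤ c4 P.d) (hbudget : 243200 * (((P.d + 2) * P.L : ℕ) : ℝ) ^ 2 * α₂ ≤ 1)
    {t : ℝ} (htop : ∀ c ∈ Λb k, ‖mlog ((dbarIterU k Wf ⟨coverAt P k c.1, c.2⟩ : (Matrix n n ℂ)ˣ) : Matrix n n ℂ)‖ ≤ t)
    (hwin : t + (C2 P.d + 64 * 60800 * (((P.d + 2) * P.L : ℕ) : ℝ) ^ 2) * α₂ ^ 2 < 2 * (P.d : ℝ) * P.L * α₁) :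
    ∀ (u : Pt P.d → (Matrix n n ℂ)ˣ) (W : Pt P.d → Fin P.d → (Matrix n n ℂ)ˣ) (A' : Pt P.d → Fin P.d → Matrix n n ℂ),
      (∀ x, u x ∈ unitaryUnits (Matrix n n ℂ)) → mgauge 1 u W = U' → Restr129 P.L k (Function.update Λs k ∅) 1 u → Lan k W →
      (∀ y τ, IsSelfAdjoint (A' y τ)) →
      (∀ j, j ≤ k → ∀ y τ, SideTouches (Ω j) y τ →
        W y τ = cfgExp η A' y τ ∧ ‖A' y τ‖ ≤ α₂ * ((P.L : ℝ) ^ j * η)⁻¹) →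
      (∀ y τ, (∀ j, j ≤ k → ¬ SideTouches (Ω j) y τ) → A' y τ = 0) →
      ∀ j, j ≤ k → ∀ c ∈ Λb j, ‖logCovIter P.L 1 (iEta η A') j c.1 c.2‖ < 2 * (P.d : ℝ) * P.L * α₁ := by
  intro u W A' hu hW h129 hLanW hsa hsock _ j hj c hc
  letI : CStarAlgebra (Matrix n n ℂ) := {}
  haveI : Nontrivial (Fin P.d) := Fin.nontrivial_iff_two_le.mpr hd2
  have hL1 : (1 : ℝ) ≤ P.L := by exact_mod_cast P.L_pos
  have hLk : (1 : ℝ) ≤ (P.L : ℝ) ^ k := one_le_pow₀ hL1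
  have hLk0 : (0 : ℝ) < (P.L : ℝ) ^ k := by positivity
  -- the torus exponent field `Af := η⁻¹·i⁻¹·log Wf`
  set Af : PBond P 0 → Matrix n n ℂ := fun b => η⁻¹ • ((Complex.I⁻¹ : ℂ) • mlog ((Wf b : (Matrix n n ℂ)ˣ) : Matrix n n ℂ)) with hAf_def
  -- junction on the comb boxes, by `log ∘ exp = id`
  have hjunc : ∀ c ∈ Λb k, AgreeOn (loK P.L k c.1) (bondHiK P.L k c.1 c.2) A' (fun w μ => Af ⟨cover P w, μ⟩) := by
    intro c hc y τ hy hyτ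
    have hyΩ : y ∈ Ω k := hbox k le_rfl c hc y hy
    obtain ⟨ν, hν⟩ := exists_ne τ
    have hs : SideTouches (Ω k) y τ := sideTouches_of_bondTouches hν (Or.inl hyΩ)
    obtain ⟨hWy, hAy⟩ := hsock k le_rfl y τ hs
    have hA2 : ‖A' y τ‖ ≤ α₂ * η⁻¹ := by
      calc ‖A' y τ‖ ≤ α₂ * ((P.L : ℝ) ^ k * η)⁻¹ := hAy
        _ = α₂ * η⁻¹ * ((P.L : ℝ) ^ k)⁻¹ := by rw [mul_inv]; ring
        _ ≤ α₂ * η⁻¹ * 1 := by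
            apply mul_le_mul_of_nonneg_left (inv_le_one_of_one_le₀ hLk) (by positivity)
        _ = α₂ * η⁻¹ := mul_one _
    have hlog := B8Prop3GaugeFixedKLevel.log_cfgExp_eq (t := α₂) hη hA2 (by linarith)
    show A' y τ = η⁻¹ • ((Complex.I⁻¹ : ℂ) • mlog ((Wf ⟨cover P y, τ⟩ : (Matrix n n ℂ)ˣ) : Matrix n n ℂ))
    rw [← hLan W hLanW c hc y τ hy hyτ, hWy]
    exact hlog.symm
  -- the torus rows on the reads, from the near-flatness of `Wf`
  have hWf : ∀ c ∈ Λb k, ∀ b : PBond P 0,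
      (iterBlockOf k b.src = (⟨coverAt P k c.1, c.2⟩ : PBond P k).src ∨ iterBlockOf k b.src = (⟨coverAt P k c.1, c.2⟩ : PBond P k).tgt) →
      (iterBlockOf k b.tgt = (⟨coverAt P k c.1, c.2⟩ : PBond P k).src ∨ iterBlockOf k b.tgt = (⟨coverAt P k c.1, c.2⟩ : PBond P k).tgt) →
        Wf b = expCfg η Af b := by
    intro c hc b hbs hbt
    have h1 : ‖((Wf b : (Matrix n n ℂ)ˣ) : Matrix n n ℂ) - 1‖ < 1 := (hWf1 c hc b hbs hbt).trans_lt (by linarith)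
    apply Units.ext
    rw [Prop8Chart.coe_expCfg, hAf_def]
    dsimp only
    rw [smul_chart_cancel hη.ne', exp_mlog h1]
  have hAf : ∀ c ∈ Λb k, ∀ b : PBond P 0,
      (iterBlockOf k b.src = (⟨coverAt P k c.1, c.2⟩ : PBond P k).src ∨ iterBlockOf k b.src = (⟨coverAt P k c.1, c.2⟩ : PBond P k).tgt) →
      (iterBlockOf k b.tgt = (⟨coverAt P k c.1, c.2⟩ : PBond P k).src ∨ iterBlockOf k b.tgt = (⟨coverAt P k c.1, c.2⟩ : PBond P k).tgt) →
        ‖Af b‖ ≤ α₂ * ((P.L : ℝ) ^ k * η)⁻¹ := by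
    intro c hc b hbs hbt
    have h1 := hWf1 c hc b hbs hbt
    have h2 := norm_mlog_le_two_mul (h1.trans hr)
    rw [hAf_def]
    dsimp only
    rw [norm_smul, norm_smul, norm_inv, norm_inv, Complex.norm_I, inv_one, one_mul, Real.norm_eq_abs, abs_of_pos hη]
    calc η⁻¹ * ‖mlog ((Wf b : (Matrix n n ℂ)ˣ) : Matrix n n ℂ)‖ ≤ η⁻¹ * (2 * r) := by
          apply mul_le_mul_of_nonneg_left (h2.trans (by linarith)) (inv_nonneg.mpr hη.le)
      _ ≤ η⁻¹ * (α₂ * ((P.L : ℝ) ^ k)⁻¹) := mul_le_mul_of_nonneg_left hr2 (inv_nonneg.mpr hη.le)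
      _ = α₂ * ((P.L : ℝ) ^ k * η)⁻¹ := by rw [mul_inv]; ring
  exact h42_top_of_below_and_knit hd2 hL hk1 hk hη hα₀ hα₁ hα₂ hα3 hα4 h16 hsmall hc₃ hsmall₁ Ω hΩ Λs Λb (fun j hj => hbox j hj.le)
    hclass h34 hAx h135 hu hW h129 hsa hsock Af Wf hjunc hWf hAf hkb hbudget htop hwin j hj c hc

end Summit.QuantumFields.YangMills.Theorems.P1FlatCoreTopH42

end
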